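import Summits.AtomisticToContinuum.BoseEinsteinCondensation.Theorems.GaussianDominationCan.Negative.LoadBearing

/-!
# Crux `GaussianDominationCan`, line `coupling-monotone-chord`: the anchor stubs A1 `ModeBessel` and
# A2 `ThetaNorm` need Bose symmetry

Negative-side support lemmas (refuter, drefute of crux item `stmt-AtomisticToContinuum-9479`) for the
registered stubs of `Cruxes/GaussianDominationCan/Lines/coupling-monotone-chord.lean` (lead reshape):

* A1 `ModeBessel`: `N·|k|²·∫_{cell^N}|ĉ_k|² ≤ ∫_{cell^N}|∇Φ|²` for every periodic Bose trial state, where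
  `ĉ_k = P₀(conj(e^{ik·x₀})ψ)` is the `k`-mode coefficient of particle `0` given the bath.  The factor
  `N = m + 1` is calibrated to the Bose symmetry of the trial class: `ModeBesselWithoutSymm` — the same
  inequality for `C¹`, periodic, normalised but NOT symmetric `ψ` — is FALSE (`modeBessel_false_without_symm`),
  witnessed by `e_n ⊗ c^{⊗(N-1)}` (`N = 2`, `L = 1`, `n = e₀`): left side `N|k|² = 8π²`, kinetic energy
  `|k|² = 4π²`.  So any proof of A1 must use `Φ.symm` (to trade `∫|∇₀ψ|²` for `T/N`).
* A2 `ThetaNorm`: `N ∫_{cell^N}|Θ|² ≤ 1`, `Θ = Σ_{S∋0}|S|^{-1/2} Q_S ψ`.  Again symmetry is load-bearing: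
  `ThetaNormWithoutSymm` is FALSE (`thetaNorm_false_without_symm`), witnessed by `c ⊗ b e_n` (particle `1`
  excited instead of particle `0`; `N = 2`, `L = 1`): only `S = {0}` survives in `Θ`, so `Θ = ψ` and
  `N‖Θ‖² = 2`.  (For the crux itself: `Negative.gaussianDominationCan_false_without_symm`.)

Also recorded, for the A1/A3 provers: the closed form of the phase-twisted cell average on the product
states `(a + b e_n) ⊗ c^{⊗(N-1)}` (`cellAvg_conj_phase_nsFun`: the constant product `b ⊗ c^{⊗(N-1)}`), its
`L²` mass `b²L³` (`lintegral_modeCoeff_nsFun`), the kinetic energy `lintegral_kineticDensity_nsFun`, and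
`Θ` of the swapped witness (`theta_swFun`).  All [folklore] (elementary witnesses).
-/

noncomputable section

namespace Summit.AtomisticToContinuum.BoseEinsteinCondensation.Theorems.GaussianDominationCan.Negative

open MeasureTheory Literature.MathematicalPhysics.QuantumManyBody.BoseGas
open scoped ENNReal NNReal ComplexConjugate

variable {L : ℝ} {m : ℕ} {n : Fin 3 → ℤ}

/-! ## A1 `ModeBessel` without symmetry -/

section ModeBessel

variable {a b c : ℝ}

/-- Stub A1 `ModeBessel` of line `coupling-monotone-chord` with the Bose symmetry of the trial state
dropped (everything else verbatim: `C¹`, periodic in every particle, normalised on the cell). -/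
def ModeBesselWithoutSymm : Prop :=
  ∀ m : ℕ, ∀ L : ℝ, 0 < L → ∀ n : Fin 3 → ℤ, ∀ ψ : Config (m + 1) → ℂ, ContDiff ℝ 1 ψ →
    (∀ (X : Config (m + 1)) (i : Fin (m + 1)) (k : Fin 3),
      ψ (X + Pi.single i (EuclideanSpace.single k L)) = ψ X) →
    ∫⁻ X in cellN (m + 1) L, (‖ψ X‖₊ : ℝ≥0∞) ^ 2 = 1 →
    ENNReal.ofReal ((m + 1 : ℝ) * (4 * Real.pi ^ 2 * nsq n / L ^ 2)) *
        ∫⁻ X in cellN (m + 1) L,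
          (‖cellAvg (m + 1) L 0 (fun Y => conj (phase m L n Y) * ψ Y) X‖₊ : ℝ≥0∞) ^ 2 ≤
      ∫⁻ X in cellN (m + 1) L, kineticDensity ψ X

/-- `∫_cell conj(e_n)·(a + b e_n) = L³ b` (`n ≠ 0`). [folklore] -/
theorem integral_conj_cellWave_mul_oneBody (hL : 0 < L) (hn : n ≠ 0) (a b : ℝ) :
    ∫ x in cell L, conj (cellWave L n x) * oneBody L n a b x = (L : ℂ) ^ 3 * b := by
  have h : ∀ x, conj (cellWave L n x) * oneBody L n a b x =
      (a : ℂ) * conj (cellWave L n x) + (b : ℂ) := by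
    intro x
    unfold oneBody
    have := conj_cellWave_mul_self L n x
    linear_combination (b : ℂ) * this
  simp_rw [h]
  rw [integral_add (integrableOn_cell (f := fun x => (a : ℂ) * conj (cellWave L n x)) (by fun_prop))
      (integrableOn_cell (f := fun _ => (b : ℂ)) continuous_const),
    integral_const_mul, integral_cell_conj_cellWave hL hn, mul_zero, zero_add, integral_cell_const hL]

/-- The phase-twisted product state is again a product state (twist folded into factor `0`). [folklore] -/
theorem conj_phase_mul_nsFun (L : ℝ) (n : Fin 3 → ℤ) (a b c : ℝ) :
    (fun Y => conj (phase m L n Y) * nsFun m L n a b c Y) =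
      prodFun (Function.update (nsFactor (m := m) L n a b c) 0
        fun x => conj (cellWave L n x) * oneBody L n a b x) := by
  funext Y
  rw [prodFun_update_fun, phase_eq_cellWave, nsFun, prodFun_eq_mul_erase _ 0 Y, nsFactor_zero]
  ring

/-- **The phase-twisted cell average of `(a + b e_n) ⊗ c^{⊗(N-1)}`** (the stub's `ĉ_k` on these states):
the constant product `b ⊗ c^{⊗(N-1)}`. [folklore] -/
theorem cellAvg_conj_phase_nsFun (hL : 0 < L) (hn : n ≠ 0) (a b c : ℝ) :
    cellAvg (m + 1) L 0 (fun Y => conj (phase m L n Y) * nsFun m L n a b c Y) =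
      prodFun (Function.update (nsFactor (m := m) L n a b c) 0 (constFactor b)) := by
  rw [conj_phase_mul_nsFun, cellAvg_prodFun, Function.update_idem]
  congr 1
  refine congrArg _ ?_
  funext x
  rw [Function.update_self]
  show avg L (fun x => conj (cellWave L n x) * oneBody L n a b x) = (b : ℂ)
  unfold avg
  rw [integral_conj_cellWave_mul_oneBody hL hn, Complex.real_smul]
  have : (L : ℂ) ≠ 0 := by exact_mod_cast hL.ne'
  push_cast
  field_simp

/-- Its `L²(cell^N)` mass: `∫ |ĉ_k|² = b² L³` when `c²L³ = 1`. [folklore] -/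
theorem lintegral_modeCoeff_nsFun (hL : 0 < L) (hn : n ≠ 0) (hc : c ^ 2 * L ^ 3 = 1) (a b : ℝ) :
    ∫⁻ X in cellN (m + 1) L,
        (‖cellAvg (m + 1) L 0 (fun Y => conj (phase m L n Y) * nsFun m L n a b c Y) X‖₊ : ℝ≥0∞) ^ 2 =
      ENNReal.ofReal (b ^ 2 * L ^ 3) := by
  rw [cellAvg_conj_phase_nsFun hL hn]
  have hcont : ∀ j, Continuous (Function.update (nsFactor (m := m) L n a b c) 0 (constFactor b) j) := by
    intro j
    by_cases hj : j = 0
    · subst hj; rw [Function.update_self]; exact continuous_constFactor b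
    · rw [Function.update_of_ne hj]; exact continuous_nsFactor L n a b c j
  rw [lintegral_nnnorm_sq_prodFun hcont, Fin.prod_univ_succ, Function.update_self,
    lintegral_nnnorm_sq_constFactor, ← ENNReal.ofReal_pow hL.le, ← ENNReal.ofReal_mul (sq_nonneg b)]
  have hrest : ∏ j : Fin m, ∫⁻ x in cell L,
      (‖Function.update (nsFactor (m := m) L n a b c) 0 (constFactor b) j.succ x‖₊ : ℝ≥0∞) ^ 2 = 1 := by
    refine Finset.prod_eq_one fun j _ => ?_
    rw [Function.update_of_ne (Fin.succ_ne_zero j), nsFactor_of_ne L n a b c (Fin.succ_ne_zero j),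
      lintegral_nnnorm_sq_constFactor' hL hc]
  rw [hrest, mul_one]

/-- The kinetic energy of `(a + b e_n) ⊗ c^{⊗(N-1)}`: `(b²L³)·4π²|n|²/L²`. [folklore] -/
theorem lintegral_kineticDensity_nsFun (hL : 0 < L) (hc : c ^ 2 * L ^ 3 = 1) :
    ∫⁻ X in cellN (m + 1) L, kineticDensity (nsFun m L n a b c) X =
      ENNReal.ofReal ((b ^ 2 * L ^ 3) * (4 * Real.pi ^ 2 * nsq n / L ^ 2)) := by
  have h := rawEnergy_nsFun (m := m) (n := n) (a := a) (b := b) hL hc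
  unfold rawEnergy at h
  simpa only [periodicInteraction_zero, zero_mul, add_zero] using h

/-- **Any proof of stub A1 must use Bose symmetry**: for `N = 2`, `L = 1`, `n = e₀` the non-symmetric
state `e_{e₀} ⊗ 1` has `N|k|²∫|ĉ_k|² = 8π²` but kinetic energy `4π²`. [folklore] -/
theorem modeBessel_false_without_symm : ¬ ModeBesselWithoutSymm := by
  intro h
  have hL : (0 : ℝ) < 1 := one_pos
  have hab : ((0 : ℝ) ^ 2 + 1 ^ 2) * (1 : ℝ) ^ 3 = 1 := by norm_num
  have hc : (1 : ℝ) ^ 2 * (1 : ℝ) ^ 3 = 1 := by norm_num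
  have key := h 1 1 hL e0 (nsFun 1 1 e0 0 1 1) (contDiff_nsFun 1 e0 0 1 1) (nsFun_periodic one_ne_zero)
    (lintegral_nnnorm_sq_nsFun hL e0_ne_zero hab hc)
  rw [lintegral_modeCoeff_nsFun hL e0_ne_zero hc, lintegral_kineticDensity_nsFun hL hc, nsq_e0,
    ← ENNReal.ofReal_mul (by positivity)] at key
  have key' := (ENNReal.ofReal_le_ofReal_iff (by positivity)).mp key
  nlinarith [Real.pi_pos, key']

end ModeBessel

/-! ## A2 `ThetaNorm` without symmetry -/

section ThetaNorm

variable {b c : ℝ}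

/-- Stub A2 `ThetaNorm` of line `coupling-monotone-chord` with the Bose symmetry of the trial state
dropped (everything else verbatim: `C¹`, periodic in every particle, normalised on the cell). -/
def ThetaNormWithoutSymm : Prop :=
  ∀ m : ℕ, ∀ L : ℝ, 0 < L → ∀ ψ : Config (m + 1) → ℂ, ContDiff ℝ 1 ψ →
    (∀ (X : Config (m + 1)) (i : Fin (m + 1)) (k : Fin 3),
      ψ (X + Pi.single i (EuclideanSpace.single k L)) = ψ X) →
    ∫⁻ X in cellN (m + 1) L, (‖ψ X‖₊ : ℝ≥0∞) ^ 2 = 1 →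
    ((m + 1 : ℕ) : ℝ≥0∞) * ∫⁻ X in cellN (m + 1) L, (‖theta m L ψ X‖₊ : ℝ≥0∞) ^ 2 ≤ 1

/-- Factors of the two-particle witness `c ⊗ b e_n` (particle `1` excited, particle `0` condensed). -/
def swFactor (L : ℝ) (n : Fin 3 → ℤ) (b c : ℝ) (j : Fin 2) : Space → ℂ :=
  if j = 0 then constFactor c else oneBody L n 0 b

/-- The witness `c ⊗ b e_n` on `Config 2`. -/
def swFun (L : ℝ) (n : Fin 3 → ℤ) (b c : ℝ) : Config 2 → ℂ := prodFun (swFactor L n b c)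

/-- Factor `0` of the witness is the constant. [folklore] -/
theorem swFactor_zero (L : ℝ) (n : Fin 3 → ℤ) (b c : ℝ) : swFactor L n b c 0 = constFactor c := if_pos rfl

/-- Factor `1` of the witness is the pure wave `b e_n`. [folklore] -/
theorem swFactor_one (L : ℝ) (n : Fin 3 → ℤ) (b c : ℝ) : swFactor L n b c 1 = oneBody L n 0 b :=
  if_neg (by decide)

/-- The witness factors are continuous. [folklore] -/
theorem continuous_swFactor (L : ℝ) (n : Fin 3 → ℤ) (b c : ℝ) (j : Fin 2) :
    Continuous (swFactor L n b c j) := by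
  unfold swFactor; split_ifs; exacts [continuous_constFactor c, continuous_oneBody L n 0 b]

/-- The witness factors are `C¹`. [folklore] -/
theorem contDiff_swFactor (L : ℝ) (n : Fin 3 → ℤ) (b c : ℝ) (j : Fin 2) :
    ContDiff ℝ 1 (swFactor L n b c j) := by
  unfold swFactor; split_ifs; exacts [contDiff_const, contDiff_oneBody L n 0 b]

/-- The witness factors are periodic. [folklore] -/
theorem swFactor_periodic (hL : L ≠ 0) (j : Fin 2) (x : Space) (k : Fin 3) :
    swFactor L n b c j (x + EuclideanSpace.single k L) = swFactor L n b c j x := by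
  unfold swFactor; split_ifs; exacts [rfl, oneBody_periodic hL 0 b x k]

/-- The filter `{S ∋ 0}` on `Fin 2` is `{ {0}, {0,1} }`. [folklore] -/
theorem filter_zero_mem_fin_two :
    (Finset.univ : Finset (Finset (Fin 2))).filter (fun S => (0 : Fin 2) ∈ S) = {{0}, {0, 1}} := by
  decide

/-- `Θ` of the witness is the witness itself: only `S = {0}` survives (`avg(b e_n) = 0` kills `S ∋ 1`,
`c - avg c = 0` kills `S ∌ 0`). [folklore] -/
theorem theta_swFun (hL : 0 < L) (hn : n ≠ 0) (X : Config 2) :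
    theta 1 L (swFun L n b c) X = swFun L n b c X := by
  unfold swFun
  rw [theta_prodFun, filter_zero_mem_fin_two, Finset.sum_pair (by decide)]
  have h0 : prodFun (fun i => factorT L ({0} : Finset (Fin 2)) i (swFactor L n b c i)) X =
      prodFun (swFactor L n b c) X := by
    unfold prodFun
    refine Finset.prod_congr rfl fun i _ => ?_
    fin_cases i
    · show factorT L ({0} : Finset (Fin 2)) 0 (swFactor L n b c 0) (X 0) = swFactor L n b c 0 (X 0)
      rw [factorT, if_pos (Finset.mem_singleton_self _), swFactor_zero]
      show avg L (constFactor c) = constFactor c (X 0)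
      rw [avg_constFactor hL c, constFactor]
    · show factorT L ({0} : Finset (Fin 2)) 1 (swFactor L n b c 1) (X 1) = swFactor L n b c 1 (X 1)
      rw [factorT, if_neg (by decide), swFactor_one]
      show oneBody L n 0 b (X 1) - avg L (oneBody L n 0 b) = oneBody L n 0 b (X 1)
      rw [avg_oneBody hL hn, Complex.ofReal_zero, sub_zero]
  have h01 : prodFun (fun i => factorT L ({0, 1} : Finset (Fin 2)) i (swFactor L n b c i)) X = 0 := by
    unfold prodFun
    rw [Fin.prod_univ_two]
    have h1 : factorT L ({0, 1} : Finset (Fin 2)) 1 (swFactor L n b c 1) (X 1) = 0 := by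
      rw [factorT, if_pos (by decide), swFactor_one]
      show avg L (oneBody L n 0 b) = 0
      rw [avg_oneBody hL hn, Complex.ofReal_zero]
    show factorT L ({0, 1} : Finset (Fin 2)) 0 (swFactor L n b c 0) (X 0) *
        factorT L ({0, 1} : Finset (Fin 2)) 1 (swFactor L n b c 1) (X 1) = 0
    rw [h1, mul_zero]
  rw [h0, h01, mul_zero, add_zero, Finset.card_singleton, Nat.cast_one, Real.sqrt_one]
  simp

/-- **Any proof of stub A2 must use Bose symmetry**: for `N = 2`, `L = 1`, `n = e₀` the non-symmetric
state `1 ⊗ e_{e₀}` has `Θ = ψ`, so `N‖Θ‖² = 2 > 1`. [folklore] -/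
theorem thetaNorm_false_without_symm : ¬ ThetaNormWithoutSymm := by
  intro h
  have hL : (0 : ℝ) < 1 := one_pos
  have hnorm : ∫⁻ X in cellN 2 1, (‖swFun 1 e0 1 1 X‖₊ : ℝ≥0∞) ^ 2 = 1 := by
    unfold swFun
    rw [lintegral_nnnorm_sq_prodFun (continuous_swFactor 1 e0 1 1), Fin.prod_univ_two, swFactor_zero,
      swFactor_one, lintegral_nnnorm_sq_constFactor' hL (by norm_num),
      lintegral_nnnorm_sq_oneBody hL e0_ne_zero]
    norm_num
  have key := h 1 1 hL (swFun 1 e0 1 1) (contDiff_prodFun (contDiff_swFactor 1 e0 1 1))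
    (prodFun_periodic (fun j x k => swFactor_periodic one_ne_zero j x k)) hnorm
  simp_rw [theta_swFun hL e0_ne_zero] at key
  rw [hnorm, mul_one] at key
  norm_num at key

end ThetaNorm

end Summit.AtomisticToContinuum.BoseEinsteinCondensation.Theorems.GaussianDominationCan.Negative

end
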